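import Summits.Schanuel.Schanuel.Theorems.RootDecomp1BDefectFloorDefs
import Summits.Schanuel.Schanuel.Theorems.RootDecomp1BTameFlagSteps

/-!
# RootDecomp1BDefectFloorCore — the DEFECT-FLOOR FACTORISATION of lens 4 gen 9 (node `DefectFloor`): gen-8 steps ⟸ floor ∧ defect-zero steps, exactness, the coordinate form of W0

Extracted mechanically (dependency closure) from HOME/decomp-schanuel-lens-4/g9/DefectFloor.lean (critic-screened node,
round 9 of RootDecomp1B); identical twins of landed `RootDecomp1BFedFlag{Defs,Core}` / `RootDecomp1BTameFlag{Defs,Core,Steps}`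
declarations are `open`ed by name, not restated; sorry-free; standard axioms.
-/

open Complex IntermediateField
open Literature.NumberTheory.Transcendental (trdeg_adjoin_le_of_le isAlgebraic_adjoin_over_algebraAdjoin nesterenko)

namespace Summit.Schanuel.Schanuel.Theorems.RootDecomp1BDefectFloorCore

set_option linter.dupNamespace false

open Summit.Schanuel.Schanuel.Theorems.RootDecomp1BTameFlagCore (TameSharpStep TameSurplusOneStep WildSharpHyperplane baseDeg IsWild LastTame trdeg_adjoin_le_cardinalMk baseDeg_lt_aleph0 pair_finite isTame_or_isWild isTame_of_lastTame baseField_le_of_coords_mem init_mem_span polarDeg_le_of_coords_mem wild_dichotomy tameKleinPolar_of_flag_steps)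
open Summit.Schanuel.Schanuel.Theorems.RootDecomp1BFedFlagCore (KleinIH polarDeg baseField polarDeg_lt_aleph0 coord_mem_span linearIndependent_init polarDeg_init_le)
open Summit.Schanuel.Schanuel.Theorems.RootDecomp1BDefectFloorDefs (SharpRelativeLindemann TameDefectZeroStep WildSharpDefectZeroStep WildSharpInitAt WildSharpInit SharpRelativeLindemannAt TameDefectZeroAt WildSharpDefectZeroAt WildSharpDefectZeroInitAt WildSharpDefectZeroInit)

section

variable {m : ℕ}

set_option synthInstance.maxHeartbeats 200000 in
/-- Tower law for generated fields: `trdeg K(S ∪ T) = trdeg K(S) + trdeg_{K(S)} K(S)(T)`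
(`trdeg_add_eq`, `adjoin_adjoin_left`). [folklore; lens-2 `DefectLattice.trdeg_adjoin_union_eq`] -/
private theorem trdeg_adjoin_union_eq {K E : Type*} [Field K] [Field E] [Algebra K E] (S T : Set E) :
    Algebra.trdeg K (adjoin K (S ∪ T)) =
      Algebra.trdeg K (adjoin K S) + Algebra.trdeg (adjoin K S) (adjoin (adjoin K S) T) := by
  have htower := trdeg_add_eq K (adjoin K S) (A := adjoin (adjoin K S) T)
  have heq : Algebra.trdeg K (adjoin (adjoin K S) T) = Algebra.trdeg K (adjoin K (S ∪ T)) := by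
    rw [← (equivOfEq (adjoin_adjoin_left K S T)).trdeg_eq]
    rfl
  rw [← heq, htower]

/-- If every coordinate of `s` lies in `span_ℚ r` then `span_ℚ s ≤ span_ℚ r`. -/
theorem span_le_of_coords_mem {k n : ℕ} {s : Fin k → ℝ} {r : Fin n → ℝ}
    (hs : ∀ j, s j ∈ Submodule.span ℚ (Set.range r)) :
    Submodule.span ℚ (Set.range s) ≤ Submodule.span ℚ (Set.range r) :=
  Submodule.span_le.mpr (by rintro _ ⟨j, rfl⟩; exact hs j)

set_option synthInstance.maxHeartbeats 200000 in
/-- WILDNESS DESCENDS TO SUB-SPANS: base change `ℚ(s) ≤ ℚ(r)` can only RAISE the relative transcendence degree of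
the pair, and it is already maximal (= 2) over `ℚ(r)`. -/
theorem isWild_of_coords_mem {k n : ℕ} {s : Fin k → ℝ} {r : Fin n → ℝ}
    (hs : ∀ j, s j ∈ Submodule.span ℚ (Set.range r)) (hW : IsWild n r) : IsWild k s := by
  intro v hv hv0
  have h2 := hW v (span_le_of_coords_mem hs hv) hv0
  have htr := trdeg_adjoin_union_eq (K := ℚ) (Set.range (fun j => ((r j : ℝ) : ℂ)))
    ({Complex.exp ((v : ℝ) : ℂ), Complex.exp (((v : ℝ) : ℂ) * Complex.I)} : Set ℂ)
  have hts := trdeg_adjoin_union_eq (K := ℚ) (Set.range (fun j => ((s j : ℝ) : ℂ)))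
    ({Complex.exp ((v : ℝ) : ℂ), Complex.exp (((v : ℝ) : ℂ) * Complex.I)} : Set ℂ)
  have hbc : Algebra.trdeg ↥(baseField r) ↥(adjoin (↥(baseField r))
      ({Complex.exp ((v : ℝ) : ℂ), Complex.exp (((v : ℝ) : ℂ) * Complex.I)} : Set ℂ)) ≤
      Algebra.trdeg ↥(baseField s) ↥(adjoin (↥(baseField s))
      ({Complex.exp ((v : ℝ) : ℂ), Complex.exp (((v : ℝ) : ℂ) * Complex.I)} : Set ℂ)) :=
    trdeg_adjoin_le_of_le (baseField_le_of_coords_mem hs) _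
  have hfs : Algebra.trdeg ↥(baseField s) ↥(adjoin (↥(baseField s))
      ({Complex.exp ((v : ℝ) : ℂ), Complex.exp (((v : ℝ) : ℂ) * Complex.I)} : Set ℂ)) < Cardinal.aleph0 :=
    (trdeg_adjoin_le_cardinalMk _).trans_lt (pair_finite v).lt_aleph0
  have hfr : Algebra.trdeg ↥(baseField r) ↥(adjoin (↥(baseField r))
      ({Complex.exp ((v : ℝ) : ℂ), Complex.exp (((v : ℝ) : ℂ) * Complex.I)} : Set ℂ)) < Cardinal.aleph0 :=
    (trdeg_adjoin_le_cardinalMk _).trans_lt (pair_finite v).lt_aleph0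
  have h2' : baseDeg r + 2 ≤ baseDeg r + Algebra.trdeg ↥(baseField r) ↥(adjoin (↥(baseField r))
      ({Complex.exp ((v : ℝ) : ℂ), Complex.exp (((v : ℝ) : ℂ) * Complex.I)} : Set ℂ)) := h2.trans (le_of_eq htr)
  suffices hgoal : baseDeg s + 2 ≤ baseDeg s + Algebra.trdeg ↥(baseField s) ↥(adjoin (↥(baseField s))
      ({Complex.exp ((v : ℝ) : ℂ), Complex.exp (((v : ℝ) : ℂ) * Complex.I)} : Set ℂ)) by
    exact hgoal.trans (le_of_eq hts.symm)
  clear h2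
  obtain ⟨nr, hnr⟩ := Cardinal.lt_aleph0.mp (baseDeg_lt_aleph0 r)
  obtain ⟨ns, hns⟩ := Cardinal.lt_aleph0.mp (baseDeg_lt_aleph0 s)
  obtain ⟨xr, hxr⟩ := Cardinal.lt_aleph0.mp hfr
  obtain ⟨xs, hxs⟩ := Cardinal.lt_aleph0.mp hfs
  rw [hnr, hxr] at h2'
  rw [hxr, hxs] at hbc
  rw [hns, hxs]
  norm_cast at h2' hbc ⊢
  omega

/-- a `ℚ`-free `(m+1)`-tuple has a coordinate outside the span of any `k ≤ m` vectors. -/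
theorem exists_coord_not_mem_span {k : ℕ} {r : Fin (m + 1) → ℝ} (hr : LinearIndependent ℚ r) (w : Fin k → ℝ)
    (hk : k ≤ m) : ∃ i, r i ∉ Submodule.span ℚ (Set.range w) := by
  classical
  by_contra h
  push Not at h
  have hs : Set.range r ⊆ ↑(Submodule.span ℚ (Set.range w)) := by
    rintro _ ⟨i, rfl⟩
    exact h i
  have h1 := linearIndependent_le_span' r hr (Set.range w) hs
  have h2 := Fintype.card_range_le w
  rw [Cardinal.mk_fintype, Fintype.card_fin] at h1
  rw [Fintype.card_fin] at h2
  norm_cast at h1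
  omega

/-- `SharpRelativeLindemann` is the conjunction of its pointwise instances `SharpRelativeLindemannAt`. -/
theorem sharpRelativeLindemann_iff_at :
    SharpRelativeLindemann ↔ ∀ (m : ℕ) (r : Fin (m + 1) → ℝ), SharpRelativeLindemannAt m r := Iff.rfl

/-- `TameDefectZeroStep` is the conjunction of its pointwise instances. -/
theorem tameDefectZeroStep_iff_at :
    TameDefectZeroStep ↔ ∀ (m : ℕ) (r : Fin (m + 1) → ℝ), TameDefectZeroAt m r := Iff.rfl

/-- `WildSharpDefectZeroStep` is the conjunction of its pointwise instances. -/
theorem wildSharpDefectZeroStep_iff_at :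
    WildSharpDefectZeroStep ↔ ∀ (m : ℕ) (r : Fin (m + 1) → ℝ), WildSharpDefectZeroAt m r := Iff.rfl

/-- Under the floor EVERY `(m+1)`-tuple over KleinIH has `t ≥ 2m + 1` (sharp hyperplane: the piece; otherwise
monotonicity `t(r) ≥ t(r') ≥ 2m + 1`). -/
theorem succ_le_polarDeg_of_floor (hF : SharpRelativeLindemann) {r : Fin (m + 1) → ℝ}
    (hr : LinearIndependent ℚ r) (hIH : KleinIH (m + 1)) : ((m + m + 1 : ℕ) : Cardinal) ≤ polarDeg r := by
  have hmono := polarDeg_init_le r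
  obtain ⟨n', hn'⟩ := Cardinal.lt_aleph0.mp (polarDeg_lt_aleph0 (Fin.init r))
  obtain ⟨n, hn⟩ := Cardinal.lt_aleph0.mp (polarDeg_lt_aleph0 r)
  rcases Nat.lt_or_ge n' (m + m + 1) with hlt | hge
  · have hle : polarDeg (Fin.init r) ≤ ((m + m : ℕ) : Cardinal) := by
      rw [hn']
      exact_mod_cast (by omega : n' ≤ m + m)
    exact hF m r hr hIH hle
  · rw [hn', hn] at hmono
    rw [hn]
    norm_cast at hmono ⊢
    omega

/-- … hence every `m`-tuple over KleinIH has `t ≥ 2m − 1`. -/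
theorem pred_le_polarDeg_of_floor (hF : SharpRelativeLindemann) {r : Fin m → ℝ} (hr : LinearIndependent ℚ r)
    (hIH : KleinIH m) : ((m + m - 1 : ℕ) : Cardinal) ≤ polarDeg r := by
  cases m with
  | zero => simp
  | succ k =>
    have e : k + 1 + (k + 1) - 1 = k + k + 1 := by omega
    rw [e]
    exact succ_le_polarDeg_of_floor hF hr hIH

/-- TSH ⟸ SRL ∧ T0: over a sharp hyperplane the floor gives `t ≥ 2m + 1`, the tame defect-zero step the rest. -/
theorem tameSharpStep_of_floor (hF : SharpRelativeLindemann) (hT : TameDefectZeroStep) : TameSharpStep :=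
  fun m r hr hIH ht hle => hT m r hr hIH ht (hF m r hr hIH hle)

/-- TS1 ⟸ T0 OUTRIGHT: over a surplus-one hyperplane `t(r) ≥ t(r') = 2m + 1` by monotonicity — the floor is free. -/
theorem tameSurplusOneStep_of_tameDefectZero (hT : TameDefectZeroStep) : TameSurplusOneStep :=
  fun m r hr hIH ht heq => hT m r hr hIH ht ((le_of_eq heq.symm).trans (polarDeg_init_le r))

/-- WSH ⟸ SRL ∧ W0, POINTWISE: the hypothesis-free floor supplies `t(r) ≥ 2m + 1`, W0 the rest (no re-basing). -/
theorem wildSharpHyperplane_of_floor (hF : SharpRelativeLindemann) (hW : WildSharpDefectZeroStep) :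
    WildSharpHyperplane :=
  fun m r hr hIH hWld hS => hW m r hr hIH hWld hS (succ_le_polarDeg_of_floor hF hr hIH)

/-- WSH in coordinate form ⟸ SRL ∧ W0 (the sharp hyperplane `Fin.init r`). -/
theorem wildSharpInit_of_floor (hF : SharpRelativeLindemann) (hW : WildSharpDefectZeroStep) : WildSharpInit :=
  fun m r hr hIH hWld hle =>
    hW m r hr hIH hWld ⟨Fin.init r, linearIndependent_init hr, init_mem_span r, hle⟩ (hF m r hr hIH hle)

/-- the three gen-8 steps from the three gen-9 pieces … -/
theorem gen8_steps_of_floor (hF : SharpRelativeLindemann) (hT : TameDefectZeroStep)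
    (hW : WildSharpDefectZeroStep) : TameSharpStep ∧ TameSurplusOneStep ∧ WildSharpHyperplane :=
  ⟨tameSharpStep_of_floor hF hT, tameSurplusOneStep_of_tameDefectZero hT, wildSharpHyperplane_of_floor hF hW⟩

/-- HYPOTHESIS-FREE FORM of the floor: «every `(m+1)`-tuple over KleinIH has polar degree `≥ 2m + 1`». -/
theorem sharpRelativeLindemann_iff_succ_le :
    SharpRelativeLindemann ↔ ∀ (m : ℕ) (r : Fin (m + 1) → ℝ), LinearIndependent ℚ r → KleinIH (m + 1) →
      ((m + m + 1 : ℕ) : Cardinal) ≤ polarDeg r :=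
  ⟨fun hF _ _ hr hIH => succ_le_polarDeg_of_floor hF hr hIH, fun h m r hr hIH _ => h m r hr hIH⟩

/-- T0 READ: «a tame `(m+1)`-tuple over KleinIH never has polar degree EXACTLY `2m + 1`». -/
theorem tameDefectZeroAt_iff_ne (r : Fin (m + 1) → ℝ) :
    TameDefectZeroAt m r ↔ (LinearIndependent ℚ r → KleinIH (m + 1) → LastTame m r →
      polarDeg r ≠ ((m + m + 1 : ℕ) : Cardinal)) := by
  unfold TameDefectZeroAt
  obtain ⟨n, hn⟩ := Cardinal.lt_aleph0.mp (polarDeg_lt_aleph0 r)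
  rw [hn]
  constructor
  · intro h hr hIH ht heq
    have h' := h hr hIH ht (le_of_eq heq.symm)
    norm_cast at h' heq
    omega
  · intro h hr hIH ht hge
    have h' := h hr hIH ht
    norm_cast at h' hge ⊢
    omega

/-- basis-free W0 at `r` ⟹ its coordinate form at `r` (the sharp hyperplane `Fin.init r`). -/
theorem wildSharpDefectZeroInitAt_of_at {r : Fin (m + 1) → ℝ} (h : WildSharpDefectZeroAt m r) :
    WildSharpDefectZeroInitAt m r :=
  fun hr hIH hW hle hfl => h hr hIH hW ⟨Fin.init r, linearIndependent_init hr, init_mem_span r, hle⟩ hfl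

/-- completing a `ℚ`-free `w ⊂ span_ℚ(r)` of length `m` by a coordinate `r i ∉ span_ℚ(w)` SPANS `span_ℚ(r)`:
every coordinate of `r` lies in `span_ℚ(w, r i)` (else `m + 2` independent vectors inside an `(m+1)`-span). -/
theorem coords_mem_span_snoc {r : Fin (m + 1) → ℝ} {w : Fin m → ℝ} (hw : LinearIndependent ℚ w)
    (hws : ∀ j, w j ∈ Submodule.span ℚ (Set.range r)) {i : Fin (m + 1)}
    (hi : r i ∉ Submodule.span ℚ (Set.range w)) :
    ∀ j, r j ∈ Submodule.span ℚ (Set.range (Fin.snoc w (r i) : Fin (m + 1) → ℝ)) := by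
  classical
  have hs : LinearIndependent ℚ (Fin.snoc w (r i) : Fin (m + 1) → ℝ) := linearIndependent_finSnoc.2 ⟨hw, hi⟩
  by_contra h
  push Not at h
  obtain ⟨j, hj⟩ := h
  have hs' : LinearIndependent ℚ (Fin.snoc (Fin.snoc w (r i) : Fin (m + 1) → ℝ) (r j) : Fin (m + 1 + 1) → ℝ) :=
    linearIndependent_finSnoc.2 ⟨hs, hj⟩
  have hk : ∀ k, (Fin.snoc (Fin.snoc w (r i) : Fin (m + 1) → ℝ) (r j) : Fin (m + 1 + 1) → ℝ) k ∈
      Submodule.span ℚ (Set.range r) := by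
    intro k
    rcases Fin.eq_castSucc_or_eq_last k with ⟨k', rfl⟩ | rfl
    · rw [Fin.snoc_castSucc]
      rcases Fin.eq_castSucc_or_eq_last k' with ⟨k'', rfl⟩ | rfl
      · rw [Fin.snoc_castSucc]; exact hws k''
      · rw [Fin.snoc_last]; exact coord_mem_span r i
    · rw [Fin.snoc_last]; exact coord_mem_span r j
  have h1 := linearIndependent_le_span' _ hs' (Set.range r) (Set.range_subset_iff.2 hk)
  have h2 := Fintype.card_range_le r
  rw [Cardinal.mk_fintype, Fintype.card_fin] at h1
  rw [Fintype.card_fin] at h2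
  norm_cast at h1
  omega

set_option synthInstance.maxHeartbeats 200000 in
/-- RE-BASING A SHARP HYPERPLANE (as gen 8's `wildSharpAt_of_wildSharpInit`): the coordinate form of W0 at all
tuples gives the basis-free form — complete the sharp `w` by a coordinate `r i ∉ span_ℚ(w)` to `s = (w, r i)`,
which spans `span_ℚ(r)` (`coords_mem_span_snoc`), so `t(s) = t(r)` and `s` is wild; `Fin.init s = w` is sharp. -/
theorem wildSharpDefectZeroAt_of_init (h : WildSharpDefectZeroInit) (r : Fin (m + 1) → ℝ) :
    WildSharpDefectZeroAt m r := by
  rintro hr hIH hW ⟨w, hw, hws, hle⟩ hfl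
  obtain ⟨i, hi⟩ := exists_coord_not_mem_span hr w le_rfl
  have hs : LinearIndependent ℚ (Fin.snoc w (r i)) := linearIndependent_finSnoc.2 ⟨hw, hi⟩
  have hss : ∀ j, (Fin.snoc w (r i) : Fin (m + 1) → ℝ) j ∈ Submodule.span ℚ (Set.range r) := by
    intro j
    rcases Fin.eq_castSucc_or_eq_last j with ⟨j', rfl⟩ | rfl
    · rw [Fin.snoc_castSucc]; exact hws j'
    · rw [Fin.snoc_last]; exact coord_mem_span r i
  have hrs := coords_mem_span_snoc hw hws hi
  have hWs : IsWild (m + 1) (Fin.snoc w (r i)) := isWild_of_coords_mem hss hW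
  have hle' : polarDeg (Fin.init (Fin.snoc w (r i) : Fin (m + 1) → ℝ)) ≤ ((m + m : ℕ) : Cardinal) := by
    rw [Fin.init_snoc]; exact hle
  have hfl' : ((m + m + 1 : ℕ) : Cardinal) ≤ polarDeg (Fin.snoc w (r i) : Fin (m + 1) → ℝ) :=
    hfl.trans (polarDeg_le_of_coords_mem hrs)
  exact (h m _ hs hIH hWs hle' hfl').trans (polarDeg_le_of_coords_mem hss)

/-- `WildSharpDefectZeroStep ⟺ WildSharpDefectZeroInit` (the piece is the basis-free closure of its coordinate form). -/
theorem wildSharpDefectZeroStep_iff_init : WildSharpDefectZeroStep ↔ WildSharpDefectZeroInit :=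
  ⟨fun h m r => wildSharpDefectZeroInitAt_of_at (h m r), fun h _ r => wildSharpDefectZeroAt_of_init h r⟩

/-- the hypothesis-free floor from the gen-8 steps: tame ⟹ X; wild ⟹ sharp hyperplane (X) | absorbing (`t ≥ 2m+1`). -/
theorem succ_le_polarDeg_of_gen8_steps (hTS : TameSharpStep) (hT1 : TameSurplusOneStep)
    (hWSH : WildSharpHyperplane) {r : Fin (m + 1) → ℝ} (hr : LinearIndependent ℚ r) (hIH : KleinIH (m + 1)) :
    ((m + m + 1 : ℕ) : Cardinal) ≤ polarDeg r := by
  have hle : ((m + m + 1 : ℕ) : Cardinal) ≤ ((m + 1 + (m + 1) : ℕ) : Cardinal) := by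
    exact_mod_cast (by omega : m + m + 1 ≤ m + 1 + (m + 1))
  rcases isTame_or_isWild r with hT | hW
  · exact hle.trans (tameKleinPolar_of_flag_steps hTS hT1 (m + 1) r hr hIH hT)
  · rcases wild_dichotomy hWSH hr hIH hW with ⟨_, hlow⟩ | hdone
    · have e : m + 1 + (m + 1) - 1 = m + m + 1 := by omega
      rw [e] at hlow
      exact hlow
    · exact hle.trans hdone

/-- SRL follows from the gen-8 steps TSH ∧ TS1 ∧ WSH. -/
theorem sharpRelativeLindemann_of_gen8_steps (hTS : TameSharpStep) (hT1 : TameSurplusOneStep)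
    (hWSH : WildSharpHyperplane) : SharpRelativeLindemann :=
  fun _ _ hr hIH _ => succ_le_polarDeg_of_gen8_steps hTS hT1 hWSH hr hIH

/-- T0 follows from the tame steps TSH ∧ TS1. -/
theorem tameDefectZeroStep_of_tame_steps (hTS : TameSharpStep) (hT1 : TameSurplusOneStep) : TameDefectZeroStep :=
  fun m r hr hIH ht _ => tameKleinPolar_of_flag_steps hTS hT1 (m + 1) r hr hIH (isTame_of_lastTame hr ht)

/-- W0 ⟸ WSH pointwise: the inserted hypothesis is simply dropped. -/
theorem wildSharpDefectZeroStep_of_wildSharpHyperplane (hWSH : WildSharpHyperplane) : WildSharpDefectZeroStep :=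
  fun m r hr hIH hW hS _ => hWSH m r hr hIH hW hS

/-- SRL ∧ T0 ∧ W0 ⟺ TSH ∧ TS1 ∧ WSH. -/
theorem gen9_pieces_iff_gen8_steps :
    (SharpRelativeLindemann ∧ TameDefectZeroStep ∧ WildSharpDefectZeroStep) ↔
      (TameSharpStep ∧ TameSurplusOneStep ∧ WildSharpHyperplane) :=
  ⟨fun h => gen8_steps_of_floor h.1 h.2.1 h.2.2,
    fun h => ⟨sharpRelativeLindemann_of_gen8_steps h.1 h.2.1 h.2.2, tameDefectZeroStep_of_tame_steps h.1 h.2.1,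
      wildSharpDefectZeroStep_of_wildSharpHyperplane h.2.2⟩⟩

end

end Summit.Schanuel.Schanuel.Theorems.RootDecomp1BDefectFloorCore
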